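import Literature.NumberTheory.EllipticCurves.PAdicLFunctionMinus
import Literature.NumberTheory.EllipticCurves.PAdicLFunctionInterpolationHoldsProofs
import Literature.NumberTheory.EllipticCurves.PAdicLFunctionDistributionProofs
import Literature.NumberTheory.EllipticCurves.ModularSymbolsNormalizedSymbolProofs
import HarnessLib

/-!
# Bounded denominators of the MINUS modular symbols `[r]⁻_f` from Manin–Drinfeld alone, and
# boundedness of the minus measure `μ⁻_{f,α}` (proofs only)

A *proofs* file (theorems only: no definition, no named fact; D-0014/D-0026), the MINUS twin of
`PAdicLFunctionInterpolationHoldsProofs` §"Rationality and bounded denominators of `[r]⁺` from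
Manin–Drinfeld alone" (`exists_forall_normalizedPlusSymbol_eq_div_of_maninDrinfeld`,
`exists_forall_ratPlusSymbol_eq_div_of_maninDrinfeld`, `exists_norm_msdMeasure_le_of_maninDrinfeld`)
for the objects of `PAdicLFunctionMinus` (`normalizedMinusSymbol f r = im (minusSymbol f r)/Ω⁻_f`,
`ratMinusSymbol f r = [r]⁻_f`, `msdMinusMeasure f α` = `μ⁻_{f,α}` of Mazur–Tate–Teitelbaum 1986
§I.8, §I.10, in the tree's normalisation `im Λ_f = ℤ · Ω⁻_f/2`).

* `exists_forall_normalizedMinusSymbol_eq_div_of_maninDrinfeld`: if every `{∞, r}_f` has a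
  positive multiple in `Λ_f` (`exists_nsmul_modularSymbol_mem_periodLattice f` — a THEOREM of the
  tree for every `f`, `exists_nsmul_modularSymbol_mem_periodLattice_holds`; for newforms of elliptic
  curves also `…_of_isNewformOf`), there is ONE `D > 0` with `[r]⁻_f ∈ (1/D)ℤ` for ALL `r ∈ ℚ`
  (`D = 4n`, `n` the uniform Manin–Drinfeld exponent of
  `exists_forall_nsmul_modularSymbol_mem_periodLattice`: `im (n{∞, ±r}) ∈ im Λ_f = ℤ Ω⁻/2`; in the
  junk case `Ω⁻_f = 0` all symbols are `0` and `D = 1`).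
* `exists_forall_ratMinusSymbol_eq_div_of_maninDrinfeld`: the same for the RATIONAL minus symbol
  `ratMinusSymbol f r` (the `dite` fires since `[r]⁻` is then rational).
* `ratCast_ratMinusSymbol_of_maninDrinfeld`: `([r]⁻ : ℝ) = normalizedMinusSymbol f r`, no newform
  hypothesis.
* `exists_norm_msdMinusMeasure_le_of_maninDrinfeld`: hence `μ⁻_{f,α}` is bounded for `‖α‖_p = 1`
  (the boundedness named as missing in the docstring of `PAdicLFunctionMinus`, now from
  Manin–Drinfeld alone; the sharper `‖·‖ ≤ 1` at `p ∤ N` is `PAdicLFunctionMinusIntegralityProofs`).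

WHY (cell `b2b-bsdres`, lane CLASS-CLOSURE, class N10, seat cc-typer-2 GEN 4): the odd-branch
(`p ≡ 3 (mod 4)`) tame-branch transport `Summits/…/Additive/TameBranchOfSemistableTwistJoin.lean` §6
(`exists_isTameBranchOf_legendreMinus_of_goodOrd/_of_mult`) carried the common denominator of the
minus symbols of the twist curve's newform as an explicit binder
`hden : ∀ r, ∃ m : ℤ, ratMinusSymbol g r = m / D` ("Manin–Drinfeld for `[·]⁻`, not in the tree");
this file discharges it. Nothing curve-specific; no label of the cell moves.

STATUS IN PRINT: Manin 1972, Cor. 3.6 (cusps are torsion in `J₀(N)`: `{∞, r} ∈ ℚ ⊗ Λ_f` with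
bounded denominators); Mazur–Tate–Teitelbaum 1986, §I.8 ("the `[a/m]^±` are rational" with a common
denominator). The statement in THIS normalisation is a theorem of the tree's definitions.

## References

* Ju. I. Manin, *Parabolic points and zeta functions of modular curves*, Izv. Akad. Nauk SSSR 36
  (1972), Cor. 3.6. [Manin1972]
* B. Mazur, J. Tate, J. Teitelbaum, *On `p`-adic analogues of the conjectures of Birch and
  Swinnerton-Dyer*, Invent. Math. 84 (1986), §I.8, §I.11. [MazurTateTeitelbaum1986Invent]
-/

noncomputable section

open scoped MatrixGroups ModularForm

open CongruenceSubgroup Literature.NumberTheory.EllipticCurves.ModularForms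

namespace Literature.NumberTheory.EllipticCurves.ModularForms

/-! ### Bounded denominators of `[r]⁻` from Manin–Drinfeld alone -/

section Rationality

variable {N : ℕ} [NeZero N] {f : CuspForm (Gamma0 N) 2}

/-- **Bounded denominators of `[r]⁻ = im minusSymbol(r)/Ω⁻` from Manin–Drinfeld alone**: if every
`{∞, r}_f` has a positive multiple in `Λ_f`, there is one `D > 0` with
`normalizedMinusSymbol f r ∈ (1/D)ℤ` for all `r ∈ ℚ`. If `im Λ_f = ℤ · Ω⁻/2` with `Ω⁻ > 0`
(`minusPeriod_eq_zero_or`): `D = 4n` with `n` the uniform exponent of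
`exists_forall_nsmul_modularSymbol_mem_periodLattice` (`im (n{∞, ±r}) = k_± Ω⁻/2`, and
`im minusSymbol(r) = (im{∞, r} − im{∞, −r})/2`); otherwise `Ω⁻_f = 0`, `[r]⁻ = 0`, `D = 1`. The MINUS
twin of `exists_forall_normalizedPlusSymbol_eq_div_of_maninDrinfeld`.
[cite: Manin1972, Cor. 3.6] [cite: MazurTateTeitelbaum1986Invent, §I.8] -/
theorem exists_forall_normalizedMinusSymbol_eq_div_of_maninDrinfeld
    (hMD : exists_nsmul_modularSymbol_mem_periodLattice f) :
    ∃ D : ℕ, 0 < D ∧ ∀ r : ℚ, ∃ m : ℤ, normalizedMinusSymbol f r = (m : ℝ) / D := by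
  rcases minusPeriod_eq_zero_or f with h0 | ⟨hpos, him⟩
  · refine ⟨1, one_pos, fun r ↦ ⟨0, ?_⟩⟩
    rw [normalizedMinusSymbol, h0, div_zero, Int.cast_zero, zero_div]
  · obtain ⟨n, hn, hmem⟩ := exists_forall_nsmul_modularSymbol_mem_periodLattice f hMD
    refine ⟨4 * n, by omega, fun r ↦ ?_⟩
    have h1 : (n • modularSymbol f r).im ∈ imagPeriods f := AddSubgroup.mem_map_of_mem _ (hmem r)
    have h2 : (n • modularSymbol f (-r)).im ∈ imagPeriods f :=
      AddSubgroup.mem_map_of_mem _ (hmem (-r))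
    rw [him, AddSubgroup.mem_zmultiples_iff] at h1 h2
    obtain ⟨k₁, hk₁⟩ := h1
    obtain ⟨k₂, hk₂⟩ := h2
    refine ⟨k₁ - k₂, ?_⟩
    rw [Complex.im_nsmul, nsmul_eq_mul, zsmul_eq_mul] at hk₁ hk₂
    have hn' : (n : ℝ) ≠ 0 := by exact_mod_cast hn.ne'
    have hminus : (minusSymbol f r).im =
        ((modularSymbol f r).im - (modularSymbol f (-r)).im) / 2 := by
      rw [minusSymbol, Complex.div_ofNat_im, Complex.sub_im]
    have hΩ0 : minusPeriod f ≠ 0 := hpos.ne'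
    rw [normalizedMinusSymbol, hminus]
    push_cast
    field_simp
    linarith [hk₁, hk₂]

/-- **Bounded denominators of the rational minus symbols `[r]⁻ = ratMinusSymbol f r` from
Manin–Drinfeld alone**: one `D > 0` with `ratMinusSymbol f r ∈ (1/D)ℤ` for ALL `r ∈ ℚ` — the
`hden` input of `TameBranchOfSemistableTwistJoin` §6 (Manin 1972, Cor. 3.6; Mazur–Tate–Teitelbaum
1986, §I.8). [cite: Manin1972, Cor. 3.6] [cite: MazurTateTeitelbaum1986Invent, §I.8] -/
theorem exists_forall_ratMinusSymbol_eq_div_of_maninDrinfeld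
    (hMD : exists_nsmul_modularSymbol_mem_periodLattice f) :
    ∃ D : ℕ, 0 < D ∧ ∀ r : ℚ, ∃ m : ℤ, ratMinusSymbol f r = (m : ℚ) / D := by
  obtain ⟨D, hD, h⟩ := exists_forall_normalizedMinusSymbol_eq_div_of_maninDrinfeld hMD
  refine ⟨D, hD, fun r ↦ ?_⟩
  obtain ⟨m, hm⟩ := h r
  refine ⟨m, ?_⟩
  have hex : ∃ q : ℚ, (q : ℝ) = normalizedMinusSymbol f r := ⟨m / D, by rw [hm]; push_cast; rfl⟩
  classical
  rw [ratMinusSymbol, dif_pos hex]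
  apply Rat.cast_injective (α := ℝ)
  rw [hex.choose_spec, hm]
  push_cast
  rfl

/-- **`([r]⁻ : ℝ) = im minusSymbol(r)/Ω⁻` from Manin–Drinfeld alone**: the rational minus symbol
casts to `normalizedMinusSymbol f r` because the latter is rational (junk case included).
[cite: MazurTateTeitelbaum1986Invent, §I.8] -/
theorem ratCast_ratMinusSymbol_of_maninDrinfeld
    (hMD : exists_nsmul_modularSymbol_mem_periodLattice f) (r : ℚ) :
    (ratMinusSymbol f r : ℝ) = normalizedMinusSymbol f r := by
  obtain ⟨D, _, h⟩ := exists_forall_normalizedMinusSymbol_eq_div_of_maninDrinfeld hMD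
  obtain ⟨m, hm⟩ := h r
  have hex : ∃ q : ℚ, (q : ℝ) = normalizedMinusSymbol f r := ⟨m / D, by rw [hm]; push_cast; rfl⟩
  classical
  rw [ratMinusSymbol, dif_pos hex]
  exact hex.choose_spec

end Rationality

end Literature.NumberTheory.EllipticCurves.ModularForms

namespace Literature.NumberTheory.EllipticCurves

/-! ### Boundedness of `μ⁻_{f,α}` from Manin–Drinfeld alone -/

section Boundedness

variable {N : ℕ} [NeZero N] {f : CuspForm (Gamma0 N) 2} {p : ℕ} [Fact p.Prime]

/-- **The minus symbols are `p`-adically bounded, from Manin–Drinfeld alone**: with `D` the common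
denominator, `‖[r]⁻_f‖_p ≤ ‖D‖_p⁻¹` for all `r`. [cite: MazurTateTeitelbaum1986Invent, §I.8] -/
theorem exists_forall_norm_ratMinusSymbol_le_of_maninDrinfeld
    (hMD : exists_nsmul_modularSymbol_mem_periodLattice f) :
    ∃ C : ℝ, 0 ≤ C ∧ ∀ r : ℚ, ‖((ratMinusSymbol f r : ℚ) : ℚ_[p])‖ ≤ C := by
  obtain ⟨D, _, hden⟩ := exists_forall_ratMinusSymbol_eq_div_of_maninDrinfeld hMD
  refine ⟨‖(D : ℚ_[p])‖⁻¹, inv_nonneg.mpr (norm_nonneg _), fun r ↦ ?_⟩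
  obtain ⟨m, hm⟩ := hden r
  rw [hm]
  push_cast
  rw [norm_div, div_eq_mul_inv]
  exact mul_le_of_le_one_left (inv_nonneg.mpr (norm_nonneg _)) (Padic.norm_int_le_one m)

/-- **`μ⁻_{f,α}` is bounded for `‖α‖_p = 1`, from Manin–Drinfeld alone** (Mazur–Tate–Teitelbaum
1986, §I.11): `‖μ⁻(a + pⁿℤ_p)‖ ≤ 2‖D‖_p⁻¹` with `D` the common denominator of the `[r]⁻_f`. The
MINUS twin of `exists_norm_msdMeasure_le_of_maninDrinfeld` (the boundedness of `μ⁻` that the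
docstring of `PAdicLFunctionMinus` names as missing; the sharper bound `≤ 1` at an odd `p ∤ N` is
`norm_msdMinusMeasure_le_one`). [cite: MazurTateTeitelbaum1986Invent, §I.10 (10.1) and §I.11] -/
theorem exists_norm_msdMinusMeasure_le_of_maninDrinfeld
    (hMD : exists_nsmul_modularSymbol_mem_periodLattice f) {α : ℚ_[p]} (hαu : ‖α‖ = 1) :
    ∃ C : ℝ, ∀ (n : ℕ) (a : ZMod (p ^ n)), ‖msdMinusMeasure f α n a‖ ≤ C := by
  obtain ⟨C, hC0, hbd⟩ := exists_forall_norm_ratMinusSymbol_le_of_maninDrinfeld (p := p) hMD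
  have hαi : ‖α⁻¹‖ = 1 := by rw [norm_inv, hαu, inv_one]
  refine ⟨2 * C, fun n a ↦ ?_⟩
  cases n with
  | zero =>
    rw [msdMinusMeasure_zero, norm_zero]
    positivity
  | succ n =>
    simp only [msdMinusMeasure]
    calc ‖α⁻¹ ^ (n + 1) * (ratMinusSymbol f ((a.val : ℚ) / (p : ℚ) ^ (n + 1)) : ℚ_[p]) -
          α⁻¹ ^ (n + 2) * (ratMinusSymbol f ((a.val : ℚ) / (p : ℚ) ^ n) : ℚ_[p])‖
        ≤ ‖α⁻¹ ^ (n + 1) * (ratMinusSymbol f ((a.val : ℚ) / (p : ℚ) ^ (n + 1)) : ℚ_[p])‖ +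
          ‖α⁻¹ ^ (n + 2) * (ratMinusSymbol f ((a.val : ℚ) / (p : ℚ) ^ n) : ℚ_[p])‖ :=
          norm_sub_le _ _
      _ ≤ C + C := by
          refine add_le_add ?_ ?_ <;>
          · rw [norm_mul, norm_pow, hαi, one_pow, one_mul]
            exact hbd _
      _ = 2 * C := by ring

end Boundedness

end Literature.NumberTheory.EllipticCurves

end
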